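import Literature.NumberTheory.ComplexMultiplication.CMTypeRank
import Mathlib.Algebra.Group.Action.Sum
import Mathlib.LinearAlgebra.Pi
import Mathlib.LinearAlgebra.Prod
import Mathlib.LinearAlgebra.Dimension.Constructions
import Mathlib.LinearAlgebra.FiniteDimensional.Lemmas
import HarnessLib

/-!
# The rank of a two-block CM type `Σ₁ ⊔ Σ₂ ⊆ E₁ ⊔ E₂`: `rank(Σ₁ ⊔ Σ₂) + 1 ≤ rank Σ₁ + rank Σ₂`, with equality
# iff the Hodge group of the product splits — and then every balanced weight splits blockwise

Companion of `NumberTheory/ComplexMultiplication/CMTypeRank` (`typeRank`, `antiVec`, `antiSpan`, `IsBalanced`,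
`IsCMTypeWith`, `typeRank_eq_finrank_antiSpan_add_one`) and of `…/CMTypeRankFamilies` (the same calculus for a family
`⊔_i E_i` indexed by a type, `typeRank_sigmaType_add_card_le/eq`).  Here the index set is a binary disjoint union
`E₁ ⊕ E₂` of two `G`-sets (Mathlib's `Sum` action) — the shape in which `Pohlmann1968/HodgeClassesProductSpanCMProducts`
glues the embeddings `⊔_i Hom(K_i, ℂ)` and `⊔_j Hom(K'_j, ℂ)` of the CM algebras of TWO products `X = ⨁ A_i`, `Y = ⨁ A'_j`
of CM abelian varieties — and the glued type is `Σ₁ ⊔ Σ₂ = {z | Sum.elim (· ∈ Σ₁) (· ∈ Σ₂) z}` (no new definition).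

Dictionary (Deligne, LNM 900, I Ex. 3.7 (c); Moonen–Zarhin 1999 §3): `typeRank G Σ = dim MT`, `dim antiSpan G Σ =
dim Hg` of the CM abelian variety (or product) with type `Σ`; so for `X`, `Y` of CM type `rank(Σ₁ ⊔ Σ₂) + 1 =
rank Σ₁ + rank Σ₂` ⟺ `dim Hg(X × Y) = dim Hg(X) + dim Hg(Y)` ⟺ `Hg(X × Y) = Hg(X) × Hg(Y)` (tori, and `Hg(X × Y) ⊆
Hg(X) × Hg(Y)` always) — Moonen–Zarhin's criterion (3.1) for "all Hodge classes on all `X^k × Y^l` come from the factors".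

## Contents (everything proved; no definition, no named fact)

* `translateInd_sum_inl/inr`, `antiVec_sum_inl/inr`, `IsCMTypeWith.sum` — bookkeeping for the glued type;
* `map_antiSpan_sum_le_prod` — under `ℚ^{E₁ ⊔ E₂} ≅ ℚ^{E₁} × ℚ^{E₂}` the antisymmetric span `U(Σ₁ ⊔ Σ₂)` (spanned by the
  `±1`-vectors `(u¹_g, u²_g)`) lies in `U(Σ₁) × U(Σ₂)`: **`typeRank_sum_add_one_le`** `rank(Σ₁ ⊔ Σ₂) + 1 ≤ rank Σ₁ + rank Σ₂`
  (`Hg(X × Y) ⊆ Hg(X) × Hg(Y)`, Gordon §3 proof / 7.7; the two-block case of `typeRank_sigmaType_add_card_le`);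
* **`map_antiSpan_sum_eq_prod_of_typeRank_eq`** — EQUALITY of ranks forces `U(Σ₁ ⊔ Σ₂) = U(Σ₁) × U(Σ₂)`;
* **`isBalanced_inl_of_typeRank_sum_eq`, `isBalanced_inr_of_typeRank_sum_eq`** — THE SPLITTING PRINCIPLE: under rank
  additivity every weight `f` on `E₁ ⊔ E₂` balanced for `Σ₁ ⊔ Σ₂` (Pohlmann's condition `2 Σ_z f(z)[g z ∈ Σ] = Σ_z f(z)` for
  all `g`) has BALANCED BLOCKS `f ∘ inl`, `f ∘ inr` (balancedness is orthogonality to all `u_g`; `(u¹_g, 0) ∈ U(Σ₁) × U(Σ₂) =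
  U(Σ₁ ⊔ Σ₂)`) — on abelian varieties: every Hodge class of `X × Y` is a sum of products of Hodge classes of `X` and `Y`;
* **`typeRank_sum_add_one_eq_of_blockwise`** — rank additivity holds when the action is BLOCKWISE INDEPENDENT (every `g`
  agrees on `E₁` with some `g₁` acting trivially on `E₂`; e.g. linearly disjoint Galois closures), the hypothesis of
  `Pohlmann1968.hodgeClassesProductSpan_biproduct_of_blockwiseIndependent` — so rank additivity is the more general
  hypothesis (strictly: two CM fields whose Galois closures meet in a real quadratic field can still be rank-additive).

NOT here: the converse "all balanced weights split ⟹ rank additivity" (true; needs the nondegeneracy of the dot product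
on `ℚ^E`), and anything about abelian varieties (see `Pohlmann1968/HodgeClassesProductSpanCMProductsRank`).

## References
* [MoonenZarhin1999LowDim] B. Moonen, Yu. Zarhin, Math. Ann. 315 (1999) 711–733, §3 (3.1).
* [Gordon1999HodgeAVSurvey] B. B. Gordon, *A survey of the Hodge conjecture for abelian varieties*, §3, 7.5–7.7, 9.1.
* [Deligne1982HodgeCycles] P. Deligne, *Hodge cycles on abelian varieties*, LNM 900 (1982), I Ex. 3.7 (c).
* [Shimura1998] G. Shimura, *Abelian Varieties with Complex Multiplication and Modular Functions* (1998), §32.10.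
-/

set_option autoImplicit false

noncomputable section

open scoped BigOperators

namespace Literature.NumberTheory.ComplexMultiplication

variable {G : Type*} [Group G] {E₁ E₂ : Type*} [MulAction G E₁] [MulAction G E₂]

/-! ### The glued type `Σ₁ ⊔ Σ₂ ⊆ E₁ ⊔ E₂` -/

section Glue
variable (Φ₁ : Set E₁) (Φ₂ : Set E₂)

/-- The indicator of a translate of `Σ₁ ⊔ Σ₂` restricts on the first block to that of `Σ₁` (`G` acts blockwise,
`g • inl x = inl (g • x)`). [cite: Deligne1982HodgeCycles, I Ex. 3.7 (c)] -/
theorem translateInd_sum_inl (g : G) (x : E₁) :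
    translateInd {z : E₁ ⊕ E₂ | Sum.elim (· ∈ Φ₁) (· ∈ Φ₂) z} g (Sum.inl x) = translateInd Φ₁ g x := by
  by_cases hx : g • x ∈ Φ₁
  · rw [translateInd_of_mem hx, translateInd_of_mem (by rw [Sum.smul_inl]; exact hx)]
  · rw [translateInd_of_not_mem hx, translateInd_of_not_mem (by rw [Sum.smul_inl]; exact hx)]

/-- The indicator of a translate of `Σ₁ ⊔ Σ₂` restricts on the second block to that of `Σ₂`.
[cite: Deligne1982HodgeCycles, I Ex. 3.7 (c)] -/
theorem translateInd_sum_inr (g : G) (y : E₂) :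
    translateInd {z : E₁ ⊕ E₂ | Sum.elim (· ∈ Φ₁) (· ∈ Φ₂) z} g (Sum.inr y) = translateInd Φ₂ g y := by
  by_cases hy : g • y ∈ Φ₂
  · rw [translateInd_of_mem hy, translateInd_of_mem (by rw [Sum.smul_inr]; exact hy)]
  · rw [translateInd_of_not_mem hy, translateInd_of_not_mem (by rw [Sum.smul_inr]; exact hy)]

/-- The `±1`-vector `u_g` of `Σ₁ ⊔ Σ₂` is `u¹_g` on the first block. [cite: Shimura1998, §32.10 (proof)] -/
theorem antiVec_sum_inl (g : G) (x : E₁) :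
    antiVec {z : E₁ ⊕ E₂ | Sum.elim (· ∈ Φ₁) (· ∈ Φ₂) z} g (Sum.inl x) = antiVec Φ₁ g x := by
  simp only [antiVec, translateInd_sum_inl]

/-- The `±1`-vector `u_g` of `Σ₁ ⊔ Σ₂` is `u²_g` on the second block. [cite: Shimura1998, §32.10 (proof)] -/
theorem antiVec_sum_inr (g : G) (y : E₂) :
    antiVec {z : E₁ ⊕ E₂ | Sum.elim (· ∈ Φ₁) (· ∈ Φ₂) z} g (Sum.inr y) = antiVec Φ₂ g y := by
  simp only [antiVec, translateInd_sum_inr]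

/-- Under `ℚ^{E₁ ⊔ E₂} ≅ ℚ^{E₁} × ℚ^{E₂}` (restriction to the blocks) the vector `u_g` of the glued type is the pair
`(u¹_g, u²_g)`. [cite: Shimura1998, §32.10 (proof)] -/
theorem sumArrowLequivProdArrow_antiVec_sum (g : G) :
    LinearEquiv.sumArrowLequivProdArrow E₁ E₂ ℚ ℚ (antiVec {z : E₁ ⊕ E₂ | Sum.elim (· ∈ Φ₁) (· ∈ Φ₂) z} g) =
      (antiVec Φ₁ g, antiVec Φ₂ g) := by
  refine Prod.ext (funext fun x => ?_) (funext fun y => ?_)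
  · rw [LinearEquiv.sumArrowLequivProdArrow_apply_fst, antiVec_sum_inl]
  · rw [LinearEquiv.sumArrowLequivProdArrow_apply_snd, antiVec_sum_inr]

variable {Φ₁ Φ₂}

/-- **`Σ₁ ⊔ Σ₂` is a CM type for `ρ`** when both blocks are (the glued type of the CM algebra `E × E'`,
"`S = Σ ⊔ ιΣ`" block by block). [cite: Deligne1982HodgeCycles, I Ex. 3.7 (p. 25)] -/
theorem IsCMTypeWith.sum {ρ : G} (h₁ : IsCMTypeWith ρ Φ₁) (h₂ : IsCMTypeWith ρ Φ₂) :
    IsCMTypeWith ρ {z : E₁ ⊕ E₂ | Sum.elim (· ∈ Φ₁) (· ∈ Φ₂) z} where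
  mem_iff z := by
    rcases z with x | y
    · rw [Sum.smul_inl]; exact h₁.mem_iff x
    · rw [Sum.smul_inr]; exact h₂.mem_iff y
  comm g z := by
    rcases z with x | y
    · rw [Sum.smul_inl, Sum.smul_inl, Sum.smul_inl, Sum.smul_inl, h₁.comm]
    · rw [Sum.smul_inr, Sum.smul_inr, Sum.smul_inr, Sum.smul_inr, h₂.comm]
  invol z := by
    rcases z with x | y
    · rw [Sum.smul_inl, Sum.smul_inl, h₁.invol]
    · rw [Sum.smul_inr, Sum.smul_inr, h₂.invol]

end Glue

/-! ### The antisymmetric span of the glued type inside `U(Σ₁) × U(Σ₂)` -/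

section Span
variable (Φ₁ : Set E₁) (Φ₂ : Set E₂)

/-- **`U(Σ₁ ⊔ Σ₂) ⊆ U(Σ₁) × U(Σ₂)`** under `ℚ^{E₁ ⊔ E₂} ≅ ℚ^{E₁} × ℚ^{E₂}`: the generators `u_g ↦ (u¹_g, u²_g)` land in the
product of the blocks' antisymmetric spans — on Hodge groups `Hg(X × Y) ⊆ Hg(X) × Hg(Y)` ("`Hg(A) ⊆ K^×_{1,1} × ⋯ ×
K^×_{r,1}`"). [cite: Gordon1999HodgeAVSurvey, §3 Theorem (Imai, Murty), proof] -/
theorem map_antiSpan_sum_le_prod :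
    (antiSpan G {z : E₁ ⊕ E₂ | Sum.elim (· ∈ Φ₁) (· ∈ Φ₂) z}).map
        (LinearEquiv.sumArrowLequivProdArrow E₁ E₂ ℚ ℚ : (E₁ ⊕ E₂ → ℚ) →ₗ[ℚ] (E₁ → ℚ) × (E₂ → ℚ)) ≤
      (antiSpan G Φ₁).prod (antiSpan G Φ₂) := by
  rw [antiSpan, Submodule.map_span, Submodule.span_le]
  rintro _ ⟨_, ⟨g, rfl⟩, rfl⟩
  show LinearEquiv.sumArrowLequivProdArrow E₁ E₂ ℚ ℚ (antiVec _ g) ∈ (antiSpan G Φ₁).prod (antiSpan G Φ₂)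
  rw [sumArrowLequivProdArrow_antiVec_sum]
  exact ⟨Submodule.subset_span ⟨g, rfl⟩, Submodule.subset_span ⟨g, rfl⟩⟩

/-- The image of `U(Σ₁ ⊔ Σ₂)` in `ℚ^{E₁} × ℚ^{E₂}` is the span of the pairs `(u¹_g, u²_g)` — the character group of
`Hg(X × Y)` inside `X(Hg X) ⊕ X(Hg Y)`. [cite: Gordon1999HodgeAVSurvey, §3 Theorem (Imai, Murty), proof] -/
theorem map_antiSpan_sum_eq_span :
    (antiSpan G {z : E₁ ⊕ E₂ | Sum.elim (· ∈ Φ₁) (· ∈ Φ₂) z}).map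
        (LinearEquiv.sumArrowLequivProdArrow E₁ E₂ ℚ ℚ : (E₁ ⊕ E₂ → ℚ) →ₗ[ℚ] (E₁ → ℚ) × (E₂ → ℚ)) =
      Submodule.span ℚ (Set.range fun g : G => (antiVec Φ₁ g, antiVec Φ₂ g)) := by
  simp only [antiSpan, Submodule.map_span, ← Set.range_comp, Function.comp_def, LinearEquiv.coe_coe,
    sumArrowLequivProdArrow_antiVec_sum]

variable [Fintype E₁] [Fintype E₂]

/-- `dim (p × q) = dim p + dim q` for submodules of two finite-dimensional spaces (the injective map
`p × q → V₁ × V₂` has range `p.prod q`). [folklore] -/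
private theorem finrank_prod_eq (p : Submodule ℚ (E₁ → ℚ)) (q : Submodule ℚ (E₂ → ℚ)) :
    Module.finrank ℚ (p.prod q) = Module.finrank ℚ p + Module.finrank ℚ q := by
  have hinj : Function.Injective (p.subtype.prodMap q.subtype) := by
    rintro ⟨a, b⟩ ⟨a', b'⟩ h
    simp only [LinearMap.prodMap_apply, Submodule.subtype_apply, Prod.mk.injEq] at h
    exact Prod.ext (Subtype.ext h.1) (Subtype.ext h.2)
  have hrange : LinearMap.range (p.subtype.prodMap q.subtype) = p.prod q := by
    rw [LinearMap.range_prodMap, Submodule.range_subtype, Submodule.range_subtype]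
  rw [← hrange, LinearMap.finrank_range_of_inj hinj, Module.finrank_prod]

/-- **`dim U(Σ₁ ⊔ Σ₂) ≤ dim U(Σ₁) + dim U(Σ₂)`** (`rank Hg(X × Y) ≤ rank Hg(X) + rank Hg(Y)`).
[cite: Gordon1999HodgeAVSurvey, 7.7] -/
theorem finrank_antiSpan_sum_le :
    Module.finrank ℚ (antiSpan G {z : E₁ ⊕ E₂ | Sum.elim (· ∈ Φ₁) (· ∈ Φ₂) z}) ≤
      Module.finrank ℚ (antiSpan G Φ₁) + Module.finrank ℚ (antiSpan G Φ₂) := by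
  rw [← LinearEquiv.finrank_map_eq (LinearEquiv.sumArrowLequivProdArrow E₁ E₂ ℚ ℚ)
      (antiSpan G {z : E₁ ⊕ E₂ | Sum.elim (· ∈ Φ₁) (· ∈ Φ₂) z}), ← finrank_prod_eq]
  exact Submodule.finrank_mono (map_antiSpan_sum_le_prod Φ₁ Φ₂)

variable {Φ₁ Φ₂} {ρ : G}

/-- **`rank(Σ₁ ⊔ Σ₂) + 1 ≤ rank Σ₁ + rank Σ₂`** for CM types `Σ₁`, `Σ₂` (`rank = dim U + 1` on each side,
`typeRank_eq_finrank_antiSpan_add_one`): `dim MT(X × Y) + 1 ≤ dim MT(X) + dim MT(Y)`, the two-block case of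
`typeRank_sigmaType_add_card_le` ("in general `rank Hg(A) ≤ rdim A`"). [cite: Gordon1999HodgeAVSurvey, 7.7] -/
theorem typeRank_sum_add_one_le [Nonempty E₁] [Nonempty E₂] (h₁ : IsCMTypeWith ρ Φ₁) (h₂ : IsCMTypeWith ρ Φ₂) :
    typeRank G {z : E₁ ⊕ E₂ | Sum.elim (· ∈ Φ₁) (· ∈ Φ₂) z} + 1 ≤ typeRank G Φ₁ + typeRank G Φ₂ := by
  rw [(h₁.sum h₂).typeRank_eq_finrank_antiSpan_add_one, h₁.typeRank_eq_finrank_antiSpan_add_one,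
    h₂.typeRank_eq_finrank_antiSpan_add_one]
  have := finrank_antiSpan_sum_le (G := G) Φ₁ Φ₂
  omega

/-- **Rank additivity forces `U(Σ₁ ⊔ Σ₂) = U(Σ₁) × U(Σ₂)`**: if `rank(Σ₁ ⊔ Σ₂) + 1 = rank Σ₁ + rank Σ₂` then the span of
the pairs `(u¹_g, u²_g)` is the whole product of the antisymmetric spans of the blocks (a subspace of the same
dimension) — `Hg(X × Y) = Hg(X) × Hg(Y)` as an equality of character groups. [cite: MoonenZarhin1999LowDim, §3 (3.1)] -/
theorem span_pair_antiVec_eq_prod_of_typeRank_eq [Nonempty E₁] [Nonempty E₂] (h₁ : IsCMTypeWith ρ Φ₁)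
    (h₂ : IsCMTypeWith ρ Φ₂)
    (hrank : typeRank G {z : E₁ ⊕ E₂ | Sum.elim (· ∈ Φ₁) (· ∈ Φ₂) z} + 1 = typeRank G Φ₁ + typeRank G Φ₂) :
    Submodule.span ℚ (Set.range fun g : G => (antiVec Φ₁ g, antiVec Φ₂ g)) =
      (antiSpan G Φ₁).prod (antiSpan G Φ₂) := by
  rw [(h₁.sum h₂).typeRank_eq_finrank_antiSpan_add_one, h₁.typeRank_eq_finrank_antiSpan_add_one,
    h₂.typeRank_eq_finrank_antiSpan_add_one] at hrank
  rw [← map_antiSpan_sum_eq_span]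
  refine Submodule.eq_of_le_of_finrank_eq (map_antiSpan_sum_le_prod Φ₁ Φ₂) ?_
  rw [LinearEquiv.finrank_map_eq, finrank_prod_eq]
  omega

/-- Under rank additivity, `(u¹_g, 0)` lies in the span of the pairs `(u¹_h, u²_h)` (`u¹_g ∈ U(Σ₁)`, `0 ∈ U(Σ₂)`).
[cite: MoonenZarhin1999LowDim, §3 (3.1)] -/
theorem pair_antiVec_zero_mem_span_of_typeRank_eq [Nonempty E₁] [Nonempty E₂] (h₁ : IsCMTypeWith ρ Φ₁)
    (h₂ : IsCMTypeWith ρ Φ₂)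
    (hrank : typeRank G {z : E₁ ⊕ E₂ | Sum.elim (· ∈ Φ₁) (· ∈ Φ₂) z} + 1 = typeRank G Φ₁ + typeRank G Φ₂) (g : G) :
    (antiVec Φ₁ g, (0 : E₂ → ℚ)) ∈ Submodule.span ℚ (Set.range fun g : G => (antiVec Φ₁ g, antiVec Φ₂ g)) := by
  rw [span_pair_antiVec_eq_prod_of_typeRank_eq h₁ h₂ hrank]
  exact ⟨Submodule.subset_span ⟨g, rfl⟩, Submodule.zero_mem _⟩

/-- Under rank additivity, `(0, u²_g)` lies in the span of the pairs `(u¹_h, u²_h)`.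
[cite: MoonenZarhin1999LowDim, §3 (3.1)] -/
theorem pair_zero_antiVec_mem_span_of_typeRank_eq [Nonempty E₁] [Nonempty E₂] (h₁ : IsCMTypeWith ρ Φ₁)
    (h₂ : IsCMTypeWith ρ Φ₂)
    (hrank : typeRank G {z : E₁ ⊕ E₂ | Sum.elim (· ∈ Φ₁) (· ∈ Φ₂) z} + 1 = typeRank G Φ₁ + typeRank G Φ₂) (g : G) :
    ((0 : E₁ → ℚ), antiVec Φ₂ g) ∈ Submodule.span ℚ (Set.range fun g : G => (antiVec Φ₁ g, antiVec Φ₂ g)) := by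
  rw [span_pair_antiVec_eq_prod_of_typeRank_eq h₁ h₂ hrank]
  exact ⟨Submodule.zero_mem _, Submodule.subset_span ⟨g, rfl⟩⟩

end Span

/-! ### Balanced weights: the splitting principle -/

section Balanced
variable [Fintype E₁] [Fintype E₂] {Φ₁ : Set E₁} {Φ₂ : Set E₂} {ρ : G}

/-- `⟨a, u_g⟩ = 2 Σ_x a(x)[g x ∈ Σ] − Σ_x a(x)`: balancedness of `a` for `Σ` is orthogonality to every `u_g`.
[cite: Gordon1999HodgeAVSurvey, §9.2 (9.2.1)] -/
theorem dotProduct_antiVec_eq {E : Type*} [Fintype E] [MulAction G E] (a : E → ℚ) (Φ : Set E) (g : G) :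
    dotProduct a (antiVec Φ g) = 2 * ∑ x, a x * translateInd Φ g x - ∑ x, a x := by
  simp only [dotProduct, antiVec, Finset.mul_sum, ← Finset.sum_sub_distrib]
  exact Finset.sum_congr rfl fun x _ => by ring

/-- Pohlmann's condition `2 Σ_x a(x)[g x ∈ Σ] = Σ_x a(x)` for all `g` iff `⟨a, u_g⟩ = 0` for all `g`.
[cite: Gordon1999HodgeAVSurvey, §9.2 (9.2.1)] -/
theorem isBalanced_iff_forall_dotProduct_antiVec {E : Type*} [Fintype E] [MulAction G E] (Φ : Set E) (a : E → ℚ) :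
    IsBalanced G Φ a ↔ ∀ g : G, dotProduct a (antiVec Φ g) = 0 := by
  refine forall_congr' fun g => ?_
  rw [dotProduct_antiVec_eq]
  constructor <;> intro h <;> linarith

/-- A weight on `E₁ ⊔ E₂` pairs with `u_g` of the glued type as the sum of the pairings of its blocks:
`⟨f, u_g⟩ = ⟨f ∘ inl, u¹_g⟩ + ⟨f ∘ inr, u²_g⟩` (Pohlmann's count (9.2.1) for the CM algebra `E × E'` splits over the two
factors). [cite: Gordon1999HodgeAVSurvey, §9.2 (9.2.1)] -/
theorem dotProduct_antiVec_sum (f : E₁ ⊕ E₂ → ℚ) (g : G) :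
    dotProduct f (antiVec {z : E₁ ⊕ E₂ | Sum.elim (· ∈ Φ₁) (· ∈ Φ₂) z} g) =
      dotProduct (f ∘ Sum.inl) (antiVec Φ₁ g) + dotProduct (f ∘ Sum.inr) (antiVec Φ₂ g) := by
  simp only [dotProduct, Fintype.sum_sum_type, Function.comp_apply, antiVec_sum_inl, antiVec_sum_inr]

/-- The functional `(v₁, v₂) ↦ ⟨f₁, v₁⟩ + ⟨f₂, v₂⟩` vanishes on the span of a set of pairs on which it vanishes. [folklore] -/
private theorem dotProduct_pair_eq_zero_of_mem_span {S : Set ((E₁ → ℚ) × (E₂ → ℚ))} (f₁ : E₁ → ℚ) (f₂ : E₂ → ℚ)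
    (hS : ∀ s ∈ S, dotProduct f₁ s.1 + dotProduct f₂ s.2 = 0) {w : (E₁ → ℚ) × (E₂ → ℚ)}
    (hw : w ∈ Submodule.span ℚ S) : dotProduct f₁ w.1 + dotProduct f₂ w.2 = 0 := by
  induction hw using Submodule.span_induction with
  | mem s hs => exact hS s hs
  | zero => simp
  | add u v _ _ hu hv =>
    rw [Prod.fst_add, Prod.snd_add, dotProduct_add, dotProduct_add]
    linarith
  | smul c u _ hu =>
    rw [Prod.smul_fst, Prod.smul_snd, dotProduct_smul, dotProduct_smul, smul_eq_mul, smul_eq_mul, ← mul_add, hu,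
      mul_zero]

/-- **The splitting principle, first block.**  If `rank(Σ₁ ⊔ Σ₂) + 1 = rank Σ₁ + rank Σ₂` (i.e. `Hg(X × Y) =
Hg(X) × Hg(Y)`), then every weight `f` on `E₁ ⊔ E₂` satisfying Pohlmann's condition for the glued type `Σ₁ ⊔ Σ₂` has a
first block `f ∘ inl` satisfying Pohlmann's condition for `Σ₁`: `f` is orthogonal to every `(u¹_g, u²_g)`, hence to
their span, which contains `(u¹_g, 0)`.  On abelian varieties: a Hodge class of `X × Y` has only components
`(Hodge class of X) ⊗ (Hodge class of Y)`. [cite: MoonenZarhin1999LowDim, §3 (3.1)] -/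
theorem isBalanced_inl_of_typeRank_sum_eq [Nonempty E₁] [Nonempty E₂] (h₁ : IsCMTypeWith ρ Φ₁)
    (h₂ : IsCMTypeWith ρ Φ₂)
    (hrank : typeRank G {z : E₁ ⊕ E₂ | Sum.elim (· ∈ Φ₁) (· ∈ Φ₂) z} + 1 = typeRank G Φ₁ + typeRank G Φ₂)
    {f : E₁ ⊕ E₂ → ℚ} (hf : IsBalanced G {z : E₁ ⊕ E₂ | Sum.elim (· ∈ Φ₁) (· ∈ Φ₂) z} f) :
    IsBalanced G Φ₁ (f ∘ Sum.inl) := by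
  rw [isBalanced_iff_forall_dotProduct_antiVec] at hf ⊢
  intro g
  have h := dotProduct_pair_eq_zero_of_mem_span (f ∘ Sum.inl) (f ∘ Sum.inr)
    (S := Set.range fun g : G => (antiVec Φ₁ g, antiVec Φ₂ g))
    (by rintro _ ⟨g', rfl⟩; rw [← dotProduct_antiVec_sum]; exact hf g')
    (pair_antiVec_zero_mem_span_of_typeRank_eq h₁ h₂ hrank g)
  simpa only [dotProduct_zero, add_zero] using h

/-- **The splitting principle, second block**: under rank additivity a weight balanced for `Σ₁ ⊔ Σ₂` has a second block
`f ∘ inr` balanced for `Σ₂`. [cite: MoonenZarhin1999LowDim, §3 (3.1)] -/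
theorem isBalanced_inr_of_typeRank_sum_eq [Nonempty E₁] [Nonempty E₂] (h₁ : IsCMTypeWith ρ Φ₁)
    (h₂ : IsCMTypeWith ρ Φ₂)
    (hrank : typeRank G {z : E₁ ⊕ E₂ | Sum.elim (· ∈ Φ₁) (· ∈ Φ₂) z} + 1 = typeRank G Φ₁ + typeRank G Φ₂)
    {f : E₁ ⊕ E₂ → ℚ} (hf : IsBalanced G {z : E₁ ⊕ E₂ | Sum.elim (· ∈ Φ₁) (· ∈ Φ₂) z} f) :
    IsBalanced G Φ₂ (f ∘ Sum.inr) := by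
  rw [isBalanced_iff_forall_dotProduct_antiVec] at hf ⊢
  intro g
  have h := dotProduct_pair_eq_zero_of_mem_span (f ∘ Sum.inl) (f ∘ Sum.inr)
    (S := Set.range fun g : G => (antiVec Φ₁ g, antiVec Φ₂ g))
    (by rintro _ ⟨g', rfl⟩; rw [← dotProduct_antiVec_sum]; exact hf g')
    (pair_zero_antiVec_mem_span_of_typeRank_eq h₁ h₂ hrank g)
  simpa only [dotProduct_zero, zero_add] using h

/-- Conversely (no rank hypothesis), a weight whose two blocks are balanced is balanced for the glued type — the
exterior product of Hodge classes is a Hodge class (the trivial inclusion in (3.1)). [cite: MoonenZarhin1999LowDim, §3 (3.1)] -/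
theorem isBalanced_sum_of_inl_inr {f : E₁ ⊕ E₂ → ℚ} (hf₁ : IsBalanced G Φ₁ (f ∘ Sum.inl))
    (hf₂ : IsBalanced G Φ₂ (f ∘ Sum.inr)) : IsBalanced G {z : E₁ ⊕ E₂ | Sum.elim (· ∈ Φ₁) (· ∈ Φ₂) z} f := by
  rw [isBalanced_iff_forall_dotProduct_antiVec] at hf₁ hf₂ ⊢
  intro g
  rw [dotProduct_antiVec_sum, hf₁ g, hf₂ g, add_zero]

end Balanced

/-! ### Blockwise independent actions are rank-additive -/

section Blockwise
variable [Fintype E₁] [Fintype E₂] {Φ₁ : Set E₁} {Φ₂ : Set E₂} {ρ : G}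

/-- `u_{gρ} = −u_g` for a CM type (the translate by `gρ` is the complement of the translate by `g`).
[cite: Shimura1998, §32.10 (proof)] -/
theorem IsCMTypeWith.antiVec_mul_rho {E : Type*} [MulAction G E] {Φ : Set E} (h : IsCMTypeWith ρ Φ) (g : G) :
    antiVec Φ (g * ρ) = -antiVec Φ g := by
  funext x
  simp only [antiVec, Pi.neg_apply, h.translateInd_mul_rho]
  ring

/-- If `g₁` acts as `g` on `E₁` then `u¹_{g₁} = u¹_g`. [folklore] -/
private theorem antiVec_eq_of_forall_smul_eq {E : Type*} [MulAction G E] (Φ : Set E) {g g₁ : G}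
    (hg : ∀ x : E, g₁ • x = g • x) : antiVec Φ g₁ = antiVec Φ g := by
  funext x
  show 2 * translateInd Φ g₁ x - 1 = 2 * translateInd Φ g x - 1
  by_cases hx : g • x ∈ Φ
  · rw [translateInd_of_mem hx, translateInd_of_mem ((hg x).symm ▸ hx)]
  · rw [translateInd_of_not_mem hx, translateInd_of_not_mem fun h => hx (hg x ▸ h)]

/-- If `g₁` acts trivially on `E` then `u_{g₁} = u_1`. [folklore] -/
private theorem antiVec_eq_antiVec_one_of_forall_smul_eq {E : Type*} [MulAction G E] (Φ : Set E) {g₁ : G}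
    (hg : ∀ y : E, g₁ • y = y) : antiVec Φ g₁ = antiVec Φ (1 : G) :=
  antiVec_eq_of_forall_smul_eq Φ fun y => by rw [hg y, one_smul]

/-- **Blockwise independent actions are rank-additive**: if every `g ∈ G` agrees on `E₁` with some `g₁ ∈ G` acting
trivially on `E₂` — the hypothesis of `Pohlmann1968.hodgeClassesProductSpan_biproduct_of_blockwiseIndependent`, e.g.
Galois closures linearly disjoint over `ℚ` — then `rank(Σ₁ ⊔ Σ₂) + 1 = rank Σ₁ + rank Σ₂`.  Proof (Gordon §3, "there is
some `σ ∈ 𝒢` that acts as `+1` on `X(K^×_{1,1})` and `−1` on the other components"): with `g₁` for `g` and `ρ₁` for `ρ`,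
`(u¹_g, u²_1)`, `(−u¹_1, u²_1)` and `(u¹_1, u²_1)` are pairs of the glued type, so `(0, u²_1)`, `(u¹_g, 0)` and then
`(0, u²_g)` lie in its antisymmetric span, which is therefore all of `U(Σ₁) × U(Σ₂)`.
[cite: Gordon1999HodgeAVSurvey, §3 Theorem (Imai, Murty), proof] -/
theorem typeRank_sum_add_one_eq_of_blockwise [Nonempty E₁] [Nonempty E₂] (h₁ : IsCMTypeWith ρ Φ₁)
    (h₂ : IsCMTypeWith ρ Φ₂) (hind : ∀ g : G, ∃ g₁ : G, (∀ x : E₁, g₁ • x = g • x) ∧ ∀ y : E₂, g₁ • y = y) :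
    typeRank G {z : E₁ ⊕ E₂ | Sum.elim (· ∈ Φ₁) (· ∈ Φ₂) z} + 1 = typeRank G Φ₁ + typeRank G Φ₂ := by
  refine le_antisymm (typeRank_sum_add_one_le h₁ h₂) ?_
  rw [(h₁.sum h₂).typeRank_eq_finrank_antiSpan_add_one, h₁.typeRank_eq_finrank_antiSpan_add_one,
    h₂.typeRank_eq_finrank_antiSpan_add_one]
  suffices hle : (antiSpan G Φ₁).prod (antiSpan G Φ₂) ≤
      Submodule.span ℚ (Set.range fun g : G => (antiVec Φ₁ g, antiVec Φ₂ g)) by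
    have h := Submodule.finrank_mono hle
    rw [finrank_prod_eq, ← map_antiSpan_sum_eq_span, LinearEquiv.finrank_map_eq] at h
    omega
  -- the pairs of the glued type
  set W := Submodule.span ℚ (Set.range fun g : G => (antiVec Φ₁ g, antiVec Φ₂ g)) with hW
  have hpair : ∀ g : G, (antiVec Φ₁ g, antiVec Φ₂ g) ∈ W := fun g => Submodule.subset_span ⟨g, rfl⟩
  -- `(u¹_g, u²_1) ∈ W`
  have hg1 : ∀ g : G, (antiVec Φ₁ g, antiVec Φ₂ (1 : G)) ∈ W := fun g => by
    obtain ⟨g₁, hg₁, hg₁'⟩ := hind g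
    rw [← antiVec_eq_of_forall_smul_eq Φ₁ hg₁, ← antiVec_eq_antiVec_one_of_forall_smul_eq Φ₂ hg₁']
    exact hpair g₁
  -- `(0, u²_1) ∈ W`: `(u¹_1, u²_1) + (u¹_ρ, u²_1) = (0, 2 u²_1)`
  have hzero1 : ((0 : E₁ → ℚ), antiVec Φ₂ (1 : G)) ∈ W := by
    have hρ : antiVec Φ₁ ρ = -antiVec Φ₁ (1 : G) := by rw [← one_mul ρ, h₁.antiVec_mul_rho]
    have hsum : ((0 : E₁ → ℚ), antiVec Φ₂ (1 : G)) =
        (1 / 2 : ℚ) • ((antiVec Φ₁ (1 : G), antiVec Φ₂ (1 : G)) + (antiVec Φ₁ ρ, antiVec Φ₂ (1 : G))) := by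
      rw [hρ, Prod.mk_add_mk, add_neg_cancel, Prod.smul_mk, smul_zero, ← two_smul ℚ (antiVec Φ₂ (1 : G)), smul_smul]
      norm_num
    rw [hsum]
    exact W.smul_mem _ (W.add_mem (hpair 1) (hg1 ρ))
  -- `(u¹_g, 0) ∈ W` and `(0, u²_g) ∈ W`
  have hleft : ∀ g : G, (antiVec Φ₁ g, (0 : E₂ → ℚ)) ∈ W := fun g => by
    have : (antiVec Φ₁ g, (0 : E₂ → ℚ)) = (antiVec Φ₁ g, antiVec Φ₂ (1 : G)) - ((0 : E₁ → ℚ), antiVec Φ₂ (1 : G)) := by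
      rw [Prod.mk_sub_mk, sub_zero, sub_self]
    rw [this]
    exact W.sub_mem (hg1 g) hzero1
  have hright : ∀ g : G, ((0 : E₁ → ℚ), antiVec Φ₂ g) ∈ W := fun g => by
    have : ((0 : E₁ → ℚ), antiVec Φ₂ g) = (antiVec Φ₁ g, antiVec Φ₂ g) - (antiVec Φ₁ g, (0 : E₂ → ℚ)) := by
      rw [Prod.mk_sub_mk, sub_zero, sub_self]
    rw [this]
    exact W.sub_mem (hpair g) (hleft g)
  -- hence `U(Σ₁) × U(Σ₂) ≤ W`
  rw [LinearMap.prod_eq_sup_map]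
  refine sup_le ?_ ?_
  · rw [antiSpan, Submodule.map_span, Submodule.span_le]
    rintro _ ⟨_, ⟨g, rfl⟩, rfl⟩
    exact hleft g
  · rw [antiSpan, Submodule.map_span, Submodule.span_le]
    rintro _ ⟨_, ⟨g, rfl⟩, rfl⟩
    exact hright g

end Blockwise

end Literature.NumberTheory.ComplexMultiplication

end
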